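import Literature.Geometry.Riemannian.HeatKernelGaussianBound
import Literature.Geometry.Riemannian.ParabolicNhdSliceVolume
import HarnessLib

/-!
# The Gaussian upper bound of the heat kernel with the entropy at the base point
# (Bamler 2020a, Thm. 7.2, last clause)

R. Bamler, *Entropy and heat kernel bounds on a Ricci flow background*, arXiv:2008.07093 (2020a),
§7.1, Thm. 7.2 (arXiv v1 Thm. 25), last sentence: "Moreover, if `[s − r², t] ⊂ I` for some
`r² ≥ ε(t − s)`, then we may replace `𝒩_{x,t}(t − s)` by `𝒩_{y,s}(r²)` in (7.15), (7.16)." Proof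
(§7.3, last half page, arXiv p. 21): by the monotonicity of the pointed Nash entropy (Prop. 5.2)
and its `W₁`-oscillation bound (Cor. 5.11),
`−𝒩_{x,t}(t−s) ≤ −𝒩_{x,t}(t−s+r²) ≤ −𝒩_{y,s}(r²) + C d^{g_s}_{W₁}(ν_{x,t;s}, δ_y) + C`
`≤ −𝒩_{y,s}(r²) + C d_s(z, y) + C` for an `H_n`-centre `(z, s)` of `(x, t)`; the linear term is
absorbed into the Gaussian of (7.15) taken with `ε/2`, and (7.16) follows by splitting
`K(y₁)K(y₂) = (K(y₁)K(y₂))^θ K(y₁)^{1−θ} K(y₂)^{1−θ}`, `θ = (8 + ε/2)/(8 + ε)`.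

This file proves the clause from the tree's Thm. 7.2 (`exists_heatKernelFn_le_gaussian`),
Prop. 5.2 (`kernelNashEntropy_mono`) and Cor. 5.11
(`IsRicciFlow.ofReal_kernelNashEntropy_sub_sub_le_mul_wassersteinW1`):

* `mul_le_exp_interpolate` — `pq ≤ e^{θα + (1−θ)(β₁+β₂)}` from `pq ≤ e^α`, `p ≤ e^{β₁}`,
  `q ≤ e^{β₂}` (`0 ≤ θ ≤ 1`);
* `neg_kernelNashEntropy_le_basePoint` — the displayed entropy estimate at general scale:
  `−𝒩*_s(x,t) ≤ −𝒩*_{s−r²}(y,s) + (m/2) log(1 + 1/ε) + Γ √H_m + Γ d_s(z,y)/√(t−s)`,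
  `Γ = (m/(2ε) + Λ)^{1/2}`, for `R ≥ R_min` on `M × [s − r², t]`, `−R_min (t − s + r²) ≤ Λ`,
  `ε(t − s) ≤ r²`, and `z` with `∫ d_s(z, ·)² dν_{x,t;s} ≤ H_m (t − s)`;
* `exists_heatKernelFn_le_gaussian_basePoint` — **Thm. 7.2, last clause**: (7.15) and (7.16)
  with `exp(−𝒩_{y,s}(r²))` resp. `exp(−2𝒩_{y₁,s}(r²))`, the lower scalar curvature bound being
  assumed on the longer slab `[s − r², t]` with `−R_min (t − s + r²) ≤ Λ`.

Everything is proved; no definitions, no named facts.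

## References

* R. H. Bamler, *Entropy and heat kernel bounds on a Ricci flow background*, arXiv:2008.07093
  (2020), §7.1 Thm. 7.2 (arXiv v1 Thm. 25); §7.3, end of the proof of Thm. 7.2; §5.1,
  Prop. 5.2, Cor. 5.11. [Bamler2020Entropy]
-/

noncomputable section

open Set Filter Function MeasureTheory Measure
open scoped Manifold ContDiff Topology ENNReal NNReal

namespace Literature.Geometry.Riemannian

open Lorentzian Lorentzian.PseudoRiemannianMetric MetricFlow

/-! ### Two elementary inequalities -/

/-- **Interpolation of exponential bounds**: if `p, q > 0`, `pq ≤ e^α`, `p ≤ e^{β₁}`,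
`q ≤ e^{β₂}` and `0 ≤ θ ≤ 1`, then `pq ≤ exp(θα + (1 − θ)(β₁ + β₂))`
(`pq = (pq)^θ p^{1−θ} q^{1−θ}`, in logarithms). [folklore] -/
theorem mul_le_exp_interpolate {p q α β₁ β₂ θ : ℝ} (hp : 0 < p) (hq : 0 < q)
    (hpq : p * q ≤ Real.exp α) (h₁ : p ≤ Real.exp β₁) (h₂ : q ≤ Real.exp β₂) (hθ0 : 0 ≤ θ)
    (hθ1 : θ ≤ 1) : p * q ≤ Real.exp (θ * α + (1 - θ) * (β₁ + β₂)) := by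
  have hlpq : Real.log (p * q) ≤ α := (Real.log_le_iff_le_exp (mul_pos hp hq)).2 hpq
  have hlp : Real.log p ≤ β₁ := (Real.log_le_iff_le_exp hp).2 h₁
  have hlq : Real.log q ≤ β₂ := (Real.log_le_iff_le_exp hq).2 h₂
  have hlog : Real.log (p * q) = Real.log p + Real.log q := Real.log_mul hp.ne' hq.ne'
  rw [← Real.log_le_iff_le_exp (mul_pos hp hq)]
  have e : Real.log (p * q) = θ * Real.log (p * q) + (1 - θ) * (Real.log p + Real.log q) := by
    rw [hlog]; ring
  rw [e]
  have hθ1' : 0 ≤ 1 - θ := sub_nonneg.2 hθ1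
  exact add_le_add (mul_le_mul_of_nonneg_left hlpq hθ0)
    (mul_le_mul_of_nonneg_left (add_le_add hlp hlq) hθ1')

/-- **Absorbing a linear term into a Gaussian**: `Γu − κu² ≤ Γ²/(4κ)` for `κ > 0`
(`κ(u − Γ/(2κ))² ≥ 0`). [folklore] -/
theorem linear_sub_mul_sq_le {Γ κ : ℝ} (hκ : 0 < κ) (u : ℝ) :
    Γ * u - κ * u ^ 2 ≤ Γ ^ 2 / (4 * κ) := by
  rw [le_div_iff₀ (by positivity)]
  nlinarith [sq_nonneg (2 * κ * u - Γ)]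

/-! ### The entropy at the base point -/

section Entropy

variable {m : ℕ} {M : Type*} [TopologicalSpace M] [ChartedSpace (EuclideanSpace ℝ (Fin m)) M]
  [IsManifold 𝓘(ℝ, EuclideanSpace ℝ (Fin m)) ∞ M] [T2Space M] [CompactSpace M]
  [SecondCountableTopology M] [MeasurableSpace M] [BorelSpace M] [ConnectedSpace M]
  {h : ℝ → PseudoRiemannianMetric 𝓘(ℝ, EuclideanSpace ℝ (Fin m)) ∞ (EuclideanSpace ℝ (Fin m))
    (TangentSpace 𝓘(ℝ, EuclideanSpace ℝ (Fin m)) : M → Type _)}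
  {cov : ℝ → CovariantDerivative 𝓘(ℝ, EuclideanSpace ℝ (Fin m)) (EuclideanSpace ℝ (Fin m))
    (TangentSpace 𝓘(ℝ, EuclideanSpace ℝ (Fin m)) : M → Type _)}
  {a T : ℝ} (hflow : IsRicciFlow h cov (Icc a T)) (hh : IsContMDiffFamilyOn ∞ h univ)
  (hR : ∀ r, (h r).IsRiemannian)

/-- **The pointed Nash entropy at `(x, t)` dominates the entropy at the base point `(y, s)` up to
a linear term in `d_s(z, y)`** (Bamler 2020a, §7.3, end of the proof of Thm. 7.2, the display
"`−𝒩_{x,1}(1) ≤ −𝒩_{x,1}(1+ε) ≤ −𝒩_{y,0}(ε) + C d_{W₁}(ν_{x,1;0}, δ_y) + C`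
`≤ −𝒩_{y,0}(r²) + C d_0(z,y) + C`",
at general scale and with explicit constants): for `a < s − r² < s < t ≤ T` (`t < T`),
`ε(t − s) ≤ r²`, `R ≥ R_min` on `M × {s − r²}` with `−R_min (t − s) ≤ Λ` (any real `Λ`), and `z`
with
`∫ d_s(z, ·)² dν_{x,t;s} ≤ H_m (t − s)`,
`−𝒩*_s(x,t) ≤ −𝒩*_{s−r²}(y,s) + (m/2) log(1 + 1/ε) + Γ √H_m + Γ d_s(z,y)/√(t−s)` with
`Γ = (m/(2ε) + Λ)^{1/2}` (Prop. 5.2 `kernelNashEntropy_mono`; Cor. 5.11 at `t* = s`;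
`d_{W₁}(δ_y, ν) ≤ d_s(y, z) + √(H_m (t − s))`).
[cite: Bamler2020Entropy, §7.3, end of the proof of Thm. 7.2; §5.1, Prop. 5.2, Cor. 5.11] -/
theorem neg_kernelNashEntropy_le_basePoint (hm : 3 ≤ m) {s t r ε Λ Rmin : ℝ} (hε : 0 < ε)
    (hasr : a < s - r ^ 2) (hst : s < t) (htT : t < T) (hr : ε * (t - s) ≤ r ^ 2)
    (hRmin : ∀ w : M, Rmin ≤ (h (s - r ^ 2)).scalarCurvatureWith (cov (s - r ^ 2)) w)
    (hRΛ : -Rmin * (t - s) ≤ Λ) (x y z : M)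
    (hz : ∫⁻ w, (h s).edist (hR s) z w ^ 2 ∂(heatKernelMeasure hh hR t x s) ≤
      ENNReal.ofReal ((((m : ℝ) - 1) * Real.pi ^ 2 / 2 + 4) * (t - s))) :
    -pointedNashEntropy h (fun r' v ↦ hflow.heatKernelFn hh hR t x (v, r')) m t s ≤
      -pointedNashEntropy h (fun r' v ↦ hflow.heatKernelFn hh hR s y (v, r')) m s (s - r ^ 2) +
        (m : ℝ) / 2 * Real.log (1 + 1 / ε) +
        Real.sqrt ((m : ℝ) / (2 * ε) + Λ) * Real.sqrt (((m : ℝ) - 1) * Real.pi ^ 2 / 2 + 4) +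
        Real.sqrt ((m : ℝ) / (2 * ε) + Λ) * ((h s).edist (hR s) z y).toReal /
          Real.sqrt (t - s) := by
  classical
  set τ : ℝ := t - s with hτ
  have hτ0 : 0 < τ := sub_pos.2 hst
  have hr2 : 0 < r ^ 2 := lt_of_lt_of_le (mul_pos hε hτ0) hr
  set σ : ℝ := s - r ^ 2 with hσ
  have hσs : σ < s := by rw [hσ]; linarith
  have htT' : t ≤ T := htT.le
  set Hm : ℝ := ((m : ℝ) - 1) * Real.pi ^ 2 / 2 + 4 with hHm
  have hHm0 : 0 ≤ Hm := by
    have h3 : (3 : ℝ) ≤ m := by exact_mod_cast hm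
    have h1 : 0 ≤ ((m : ℝ) - 1) * Real.pi ^ 2 := mul_nonneg (by linarith) (sq_nonneg _)
    rw [hHm]; linarith
  set Γ : ℝ := Real.sqrt ((m : ℝ) / (2 * ε) + Λ) with hΓ
  have hΓ0 : 0 ≤ Γ := Real.sqrt_nonneg _
  set d : ℝ := ((h s).edist (hR s) z y).toReal with hd
  have hd0 : 0 ≤ d := ENNReal.toReal_nonneg
  -- Prop. 5.2: `𝒩*_σ(x,t) ≤ 𝒩*_s(x,t)`
  have hmono := kernelNashEntropy_mono hflow hh hR hm hasr hσs.le hst htT' x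
  -- Cor. 5.11 at `t* = s`, `(x₁,t₁) = (y,s)`, `(x₂,t₂) = (x,t)`
  set L : ℝ := Real.sqrt ((m : ℝ) / (2 * (s - σ)) - Rmin) with hL
  have hL0 : 0 ≤ L := Real.sqrt_nonneg _
  have hcor := hflow.ofReal_kernelNashEntropy_sub_sub_le_mul_wassersteinW1 hh hR hm hasr hσs
    le_rfl hst.le (hst.trans htT) htT' hRmin y x
  -- the `W₁`-distance: `d_{W₁}(δ_y, ν_{x,t;s}) ≤ d_s(y,z) + √(H_m τ)` (in the metric flow)
  have hs_mem : s ∈ Icc a T := ⟨(hasr.trans hσs).le, (hst.trans htT).le⟩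
  have ht_mem : t ∈ Icc a T := ⟨((hasr.trans hσs).trans hst).le, htT'⟩
  set 𝒳 : MetricFlow (Icc a T) := ricciFlowMetricFlow hh hR Set.ordConnected_Icc hflow with h𝒳
  have hle : ((⟨s, hs_mem⟩ : Icc a T) : ℝ) ≤ (⟨t, ht_mem⟩ : Icc a T) := hst.le
  haveI := 𝒳.isProbabilityMeasure_condKernel (s := ⟨s, hs_mem⟩) (t := ⟨t, ht_mem⟩) x hle
  have hzc : 𝒳.IsHCenter Hm (s := ⟨s, hs_mem⟩) (t := ⟨t, ht_mem⟩) z x := by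
    refine ⟨hle, ?_⟩
    rw [variance_dirac_left]
    exact hz
  have hW : wassersteinW1 (Measure.dirac y : Measure (𝒳.Slice ⟨s, hs_mem⟩))
      (𝒳.condKernel (t := ⟨t, ht_mem⟩) x ⟨s, hs_mem⟩) ≤
      ENNReal.ofReal (d + Real.sqrt (Hm * τ)) := by
    calc wassersteinW1 (Measure.dirac y : Measure (𝒳.Slice ⟨s, hs_mem⟩))
          (𝒳.condKernel (t := ⟨t, ht_mem⟩) x ⟨s, hs_mem⟩)
        ≤ wassersteinW1 (Measure.dirac y : Measure (𝒳.Slice ⟨s, hs_mem⟩))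
              (Measure.dirac z : Measure (𝒳.Slice ⟨s, hs_mem⟩)) +
            wassersteinW1 (Measure.dirac z : Measure (𝒳.Slice ⟨s, hs_mem⟩))
              (𝒳.condKernel (t := ⟨t, ht_mem⟩) x ⟨s, hs_mem⟩) := wassersteinW1_triangle _ _ _
      _ ≤ ENNReal.ofReal d + ENNReal.ofReal (Real.sqrt (Hm * τ)) := by
          refine add_le_add ?_ ?_
          · rw [wassersteinW1_dirac_dirac, PseudoEMetricSpace.edist_comm]
            show (h s).edist (hR s) z y ≤ ENNReal.ofReal d
            rw [hd, ENNReal.ofReal_toReal (PseudoRiemannianMetric.edist_ne_top (hR s) z y)]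
          · refine hzc.wassersteinW1_dirac_le.trans ?_
            have := ofReal_mul_rpow_half_le_ofReal_sqrt_mul (H := Hm) (τ := τ) (Θ := 1)
              (ρ := Real.sqrt τ) hHm0 hτ0.le (Real.sqrt_nonneg _)
              (by rw [Real.sq_sqrt hτ0.le, one_mul])
            rwa [mul_one, ← Real.sqrt_mul hHm0] at this
      _ = ENNReal.ofReal (d + Real.sqrt (Hm * τ)) :=
          (ENNReal.ofReal_add hd0 (Real.sqrt_nonneg _)).symm
  -- the kernel of `(y, s)` at time `s` is `δ_y`
  have hself : heatKernelMeasure hh hR s y s = Measure.dirac y := heatKernelMeasure_self hh hR s y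
  rw [hself] at hcor
  have hc := hcor.trans (mul_le_mul' le_rfl hW)
  rw [← ENNReal.ofReal_mul hL0, ENNReal.ofReal_le_ofReal_iff (by positivity)] at hc
  -- the logarithm: `(t − σ)/(s − σ) = 1 + τ/r² ≤ 1 + 1/ε`
  have hsσ : s - σ = r ^ 2 := by rw [hσ]; ring
  have hlog : (m : ℝ) / 2 * Real.log ((t - σ) / (s - σ)) ≤ (m : ℝ) / 2 * Real.log (1 + 1 / ε) := by
    refine mul_le_mul_of_nonneg_left (Real.log_le_log
      (by rw [hsσ]; exact div_pos (by linarith [hσs, hst]) hr2) ?_) (by positivity)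
    rw [hsσ, div_le_iff₀ hr2]
    have h1 : τ ≤ 1 / ε * r ^ 2 := by
      rw [one_div, ← div_eq_inv_mul, le_div_iff₀ hε]; linarith
    have : t - σ = τ + r ^ 2 := by rw [hσ, hτ]; ring
    rw [this]; linarith
  -- `L ≤ Γ/√τ`: `L² τ = m τ/(2r²) − R_min τ ≤ m/(2ε) + Λ`
  have hLΓ : L * Real.sqrt τ ≤ Γ := by
    rw [hL, hΓ, ← Real.sqrt_mul' _ hτ0.le]
    refine Real.sqrt_le_sqrt ?_
    rw [hsσ]
    have h1 : (m : ℝ) / (2 * r ^ 2) * τ ≤ (m : ℝ) / (2 * ε) := by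
      rw [div_mul_eq_mul_div, div_le_div_iff₀ (by positivity) (by positivity)]
      have : (m : ℝ) * (ε * τ) ≤ (m : ℝ) * r ^ 2 := mul_le_mul_of_nonneg_left hr (Nat.cast_nonneg _)
      nlinarith
    nlinarith
  have hsq : 0 < Real.sqrt τ := Real.sqrt_pos.2 hτ0
  have hLd : L * d ≤ Γ * d / Real.sqrt τ := by
    rw [le_div_iff₀ hsq]
    calc L * d * Real.sqrt τ = L * Real.sqrt τ * d := by ring
      _ ≤ Γ * d := mul_le_mul_of_nonneg_right hLΓ hd0
  have hLH : L * Real.sqrt (Hm * τ) ≤ Γ * Real.sqrt Hm := by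
    rw [Real.sqrt_mul hHm0, show L * (Real.sqrt Hm * Real.sqrt τ) = L * Real.sqrt τ * Real.sqrt Hm
      by ring]
    exact mul_le_mul_of_nonneg_right hLΓ (Real.sqrt_nonneg _)
  have hmul : L * (d + Real.sqrt (Hm * τ)) ≤ Γ * d / Real.sqrt τ + Γ * Real.sqrt Hm := by
    rw [mul_add]; exact add_le_add hLd hLH
  have e1 : Γ * ((h s).edist (hR s) z y).toReal / Real.sqrt (t - s) = Γ * d / Real.sqrt τ := rfl
  rw [e1]
  linarith [hmono, hc, hlog, hmul]

/-- The common shape `c τᵖ e^A e^B = exp(log c + p log τ + A + B)` of the Gaussian bounds.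
[folklore] -/
theorem mul_rpow_mul_exp_mul_exp_eq {c τ : ℝ} (hc : 0 < c) (hτ : 0 < τ) (p A B : ℝ) :
    c * τ ^ p * Real.exp A * Real.exp B = Real.exp (Real.log c + Real.log τ * p + A + B) := by
  rw [Real.exp_add, Real.exp_add, Real.exp_add, Real.exp_log hc, ← Real.rpow_def_of_pos hτ]

/-- **(7.15) with the entropy at the base point, from (7.15) with `ε/2`** (Bamler 2020a, §7.3,
end of the proof of Thm. 7.2: "So by (7.15), with `ε` replaced with `ε/2`,
`K(x,1;y,0) ≤ C e^{−𝒩_{y,0}(r²)} exp(−d_0²(z,y)/(8+ε/2) + C d_0(z,y))`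
`≤ C e^{−𝒩_{y,0}(r²)} exp(−d_0²(z,y)/(8+ε))`"):
the entropy estimate `neg_kernelNashEntropy_le_basePoint` and the absorption
`Γu − κu² ≤ Γ²/(4κ)`, `κ = 1/(8+ε/2) − 1/(8+ε)`, `u = d_s(z,y)/√(t−s)`.
[cite: Bamler2020Entropy, §7.3, end of the proof of Thm. 7.2] -/
theorem heatKernelFn_le_gaussian_basePoint_of_le (hm : 3 ≤ m) {s t r ε Λ Rmin C₁ E : ℝ}
    (hε : 0 < ε) (hasr : a < s - r ^ 2) (hst : s < t) (htT : t < T)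
    (hr : ε * (t - s) ≤ r ^ 2)
    (hRmin : ∀ w : M, Rmin ≤ (h (s - r ^ 2)).scalarCurvatureWith (cov (s - r ^ 2)) w)
    (hRΛ : -Rmin * (t - s) ≤ Λ) (hC₁ : 0 < C₁)
    (hE : |Real.log C₁| + (m : ℝ) / 2 * Real.log (1 + 1 / ε) +
      Real.sqrt ((m : ℝ) / (2 * ε) + Λ) * Real.sqrt (((m : ℝ) - 1) * Real.pi ^ 2 / 2 + 4) +
      Real.sqrt ((m : ℝ) / (2 * ε) + Λ) ^ 2 / (4 * (1 / (8 + ε / 2) - 1 / (8 + ε))) ≤ E)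
    (x y z : M)
    (hz : ∫⁻ w, (h s).edist (hR s) z w ^ 2 ∂(heatKernelMeasure hh hR t x s) ≤
      ENNReal.ofReal ((((m : ℝ) - 1) * Real.pi ^ 2 / 2 + 4) * (t - s)))
    (h15 : hflow.heatKernelFn hh hR t x (y, s) ≤
      C₁ * (t - s) ^ (-(m : ℝ) / 2) *
        Real.exp (-(pointedNashEntropy h (fun r' v ↦ hflow.heatKernelFn hh hR t x (v, r')) m t s)) *
        Real.exp (-((h s).edist (hR s) z y).toReal ^ 2 / ((8 + ε / 2) * (t - s)))) :
    hflow.heatKernelFn hh hR t x (y, s) ≤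
      Real.exp E * (t - s) ^ (-(m : ℝ) / 2) *
        Real.exp (-(pointedNashEntropy h (fun r' v ↦ hflow.heatKernelFn hh hR s y (v, r')) m s
          (s - r ^ 2))) *
        Real.exp (-((h s).edist (hR s) z y).toReal ^ 2 / ((8 + ε) * (t - s))) := by
  have hτ0 : 0 < t - s := sub_pos.2 hst
  have hN := neg_kernelNashEntropy_le_basePoint hflow hh hR hm hε hasr hst htT hr hRmin hRΛ x y z hz
  set τ : ℝ := t - s with hτ
  set Γ : ℝ := Real.sqrt ((m : ℝ) / (2 * ε) + Λ) with hΓ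
  set κ : ℝ := 1 / (8 + ε / 2) - 1 / (8 + ε) with hκ
  have hκ0 : 0 < κ := by
    rw [hκ, sub_pos]
    exact one_div_lt_one_div_of_lt (by positivity) (by linarith)
  set d : ℝ := ((h s).edist (hR s) z y).toReal with hd
  set w : ℝ := d / Real.sqrt τ with hw
  have hsq : 0 < Real.sqrt τ := Real.sqrt_pos.2 hτ0
  have hw2 : w ^ 2 = d ^ 2 / τ := by rw [hw, div_pow, Real.sq_sqrt hτ0.le]
  have h8 : (8 : ℝ) + ε / 2 ≠ 0 := by positivity
  have h8' : (8 : ℝ) + ε ≠ 0 := by positivity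
  have hG : -d ^ 2 / ((8 + ε / 2) * τ) = -(w ^ 2 / (8 + ε / 2)) := by
    rw [hw2]; field_simp
  have hG' : -d ^ 2 / ((8 + ε) * τ) = -(w ^ 2 / (8 + ε)) := by
    rw [hw2]; field_simp
  have hΓw : Γ * d / Real.sqrt τ = Γ * w := by rw [hw, mul_div_assoc]
  rw [hΓw] at hN
  have hκw : w ^ 2 / (8 + ε / 2) = w ^ 2 / (8 + ε) + κ * w ^ 2 := by rw [hκ]; ring
  have habs := linear_sub_mul_sq_le hκ0 w (Γ := Γ)
  have hlc : Real.log C₁ ≤ |Real.log C₁| := le_abs_self _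
  rw [mul_rpow_mul_exp_mul_exp_eq hC₁ hτ0, hG] at h15
  rw [mul_rpow_mul_exp_mul_exp_eq (Real.exp_pos E) hτ0, hG', Real.log_exp]
  refine h15.trans (Real.exp_le_exp.2 ?_)
  linarith [hN, habs, hlc, hκw, hE]

/-- **(7.16) with the entropy at the base point, from (7.15) and (7.16) with `ε/2`** (Bamler
2020a, §7.3, end of the proof of Thm. 7.2:
"`K(y)K(y′) = (K(y)K(y′))^{(8+ε/2)/(8+ε)} K(y)^{(ε/2)/(8+ε)} K(y′)^{(ε/2)/(8+ε)} ≤ …`"):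
interpolation of the three bounds in logarithms (`mul_le_exp_interpolate`, `θ = (8+ε/2)/(8+ε)`),
the entropy estimate at `y₁` and the absorption `2Γu₁ − κu₁² ≤ Γ²/κ`.
[cite: Bamler2020Entropy, §7.3, end of the proof of Thm. 7.2] -/
theorem heatKernelFn_mul_le_gaussian_basePoint_of_le (hm : 3 ≤ m) {s t r ε Λ Rmin C₁ E : ℝ}
    (hε : 0 < ε) (hasr : a < s - r ^ 2) (hst : s < t) (htT : t < T)
    (hr : ε * (t - s) ≤ r ^ 2)
    (hRmin : ∀ w : M, Rmin ≤ (h (s - r ^ 2)).scalarCurvatureWith (cov (s - r ^ 2)) w)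
    (hRΛ : -Rmin * (t - s) ≤ Λ) (hC₁ : 0 < C₁)
    (hE : 2 * |Real.log C₁| + 2 * ((m : ℝ) / 2 * Real.log (1 + 1 / ε) +
      Real.sqrt ((m : ℝ) / (2 * ε) + Λ) * Real.sqrt (((m : ℝ) - 1) * Real.pi ^ 2 / 2 + 4)) +
      (2 * Real.sqrt ((m : ℝ) / (2 * ε) + Λ)) ^ 2 / (4 * (1 / (8 + ε / 2) - 1 / (8 + ε))) ≤ E)
    (x y₁ y₂ z : M) (hK₁ : 0 < hflow.heatKernelFn hh hR t x (y₁, s))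
    (hK₂ : 0 < hflow.heatKernelFn hh hR t x (y₂, s))
    (hz : ∫⁻ w, (h s).edist (hR s) z w ^ 2 ∂(heatKernelMeasure hh hR t x s) ≤
      ENNReal.ofReal ((((m : ℝ) - 1) * Real.pi ^ 2 / 2 + 4) * (t - s)))
    (h₁ : hflow.heatKernelFn hh hR t x (y₁, s) ≤
      C₁ * (t - s) ^ (-(m : ℝ) / 2) *
        Real.exp (-(pointedNashEntropy h (fun r' v ↦ hflow.heatKernelFn hh hR t x (v, r')) m t s)) *
        Real.exp (-((h s).edist (hR s) z y₁).toReal ^ 2 / ((8 + ε / 2) * (t - s))))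
    (h₂ : hflow.heatKernelFn hh hR t x (y₂, s) ≤
      C₁ * (t - s) ^ (-(m : ℝ) / 2) *
        Real.exp (-(pointedNashEntropy h (fun r' v ↦ hflow.heatKernelFn hh hR t x (v, r')) m t s)) *
        Real.exp (-((h s).edist (hR s) z y₂).toReal ^ 2 / ((8 + ε / 2) * (t - s))))
    (h₁₂ : hflow.heatKernelFn hh hR t x (y₁, s) * hflow.heatKernelFn hh hR t x (y₂, s) ≤
      C₁ * (t - s) ^ (-(m : ℝ)) *
        Real.exp (-2 * pointedNashEntropy h (fun r' v ↦ hflow.heatKernelFn hh hR t x (v, r')) m t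
          s) *
        Real.exp (-((h s).edist (hR s) y₁ y₂).toReal ^ 2 / ((8 + ε / 2) * (t - s)))) :
    hflow.heatKernelFn hh hR t x (y₁, s) * hflow.heatKernelFn hh hR t x (y₂, s) ≤
      Real.exp E * (t - s) ^ (-(m : ℝ)) *
        Real.exp (-2 * pointedNashEntropy h (fun r' v ↦ hflow.heatKernelFn hh hR s y₁ (v, r')) m s
          (s - r ^ 2)) *
        Real.exp (-((h s).edist (hR s) y₁ y₂).toReal ^ 2 / ((8 + ε) * (t - s))) := by
  have hτ0 : 0 < t - s := sub_pos.2 hst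
  have hN := neg_kernelNashEntropy_le_basePoint hflow hh hR hm hε hasr hst htT hr hRmin hRΛ x y₁ z
    hz
  set τ : ℝ := t - s with hτ
  set Γ : ℝ := Real.sqrt ((m : ℝ) / (2 * ε) + Λ) with hΓ
  set κ : ℝ := 1 / (8 + ε / 2) - 1 / (8 + ε) with hκ
  have hκ0 : 0 < κ := by
    rw [hκ, sub_pos]
    exact one_div_lt_one_div_of_lt (by positivity) (by linarith)
  set θ : ℝ := (8 + ε / 2) / (8 + ε) with hθ
  have hθ0 : 0 ≤ θ := by positivity
  have hθ1 : θ ≤ 1 := by rw [hθ, div_le_one (by positivity)]; linarith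
  have hsq : 0 < Real.sqrt τ := Real.sqrt_pos.2 hτ0
  have h8 : (8 : ℝ) + ε / 2 ≠ 0 := by positivity
  have h8' : (8 : ℝ) + ε ≠ 0 := by positivity
  -- normalised distances
  set d₁ : ℝ := ((h s).edist (hR s) z y₁).toReal with hd₁
  set d₂ : ℝ := ((h s).edist (hR s) z y₂).toReal with hd₂
  set d₁₂ : ℝ := ((h s).edist (hR s) y₁ y₂).toReal with hd₁₂
  set w₁ : ℝ := d₁ / Real.sqrt τ with hw₁
  set w₂ : ℝ := d₂ / Real.sqrt τ with hw₂
  set w₁₂ : ℝ := d₁₂ / Real.sqrt τ with hw₁₂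
  have hsq2 : Real.sqrt τ ^ 2 = τ := Real.sq_sqrt hτ0.le
  have hG₁ : -d₁ ^ 2 / ((8 + ε / 2) * τ) = -(w₁ ^ 2 / (8 + ε / 2)) := by
    rw [hw₁, div_pow, hsq2]; field_simp
  have hG₂ : -d₂ ^ 2 / ((8 + ε / 2) * τ) = -(w₂ ^ 2 / (8 + ε / 2)) := by
    rw [hw₂, div_pow, hsq2]; field_simp
  have hG₁₂ : -d₁₂ ^ 2 / ((8 + ε / 2) * τ) = -(w₁₂ ^ 2 / (8 + ε / 2)) := by
    rw [hw₁₂, div_pow, hsq2]; field_simp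
  have hG₁₂' : -d₁₂ ^ 2 / ((8 + ε) * τ) = -(w₁₂ ^ 2 / (8 + ε)) := by
    rw [hw₁₂, div_pow, hsq2]; field_simp
  have hΓw : Γ * d₁ / Real.sqrt τ = Γ * w₁ := by rw [hw₁, mul_div_assoc]
  rw [hΓw] at hN
  -- the three bounds in exponential form
  rw [mul_rpow_mul_exp_mul_exp_eq hC₁ hτ0, hG₁] at h₁
  rw [mul_rpow_mul_exp_mul_exp_eq hC₁ hτ0, hG₂] at h₂
  rw [mul_rpow_mul_exp_mul_exp_eq hC₁ hτ0, hG₁₂] at h₁₂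
  have hint := mul_le_exp_interpolate hK₁ hK₂ h₁₂ h₁ h₂ hθ0 hθ1
  rw [mul_rpow_mul_exp_mul_exp_eq (Real.exp_pos E) hτ0, hG₁₂', Real.log_exp]
  refine hint.trans (Real.exp_le_exp.2 ?_)
  -- the exponent
  set lc : ℝ := Real.log C₁ with hlc
  set N : ℝ := pointedNashEntropy h (fun r' v ↦ hflow.heatKernelFn hh hR t x (v, r')) m t s
    with hNdef
  have hθa : θ / (8 + ε / 2) = 1 / (8 + ε) := by rw [hθ]; field_simp
  have hθb : (1 - θ) / (8 + ε / 2) = κ := by rw [hθ, hκ]; field_simp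
  have hexp : θ * (lc + Real.log τ * (-(m : ℝ)) + -2 * N + -(w₁₂ ^ 2 / (8 + ε / 2))) +
      (1 - θ) * (lc + Real.log τ * (-(m : ℝ) / 2) + -N + -(w₁ ^ 2 / (8 + ε / 2)) +
        (lc + Real.log τ * (-(m : ℝ) / 2) + -N + -(w₂ ^ 2 / (8 + ε / 2)))) =
      (2 - θ) * lc + Real.log τ * (-(m : ℝ)) + -2 * N + -(θ / (8 + ε / 2) * w₁₂ ^ 2) +
        -((1 - θ) / (8 + ε / 2) * (w₁ ^ 2 + w₂ ^ 2)) := by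
    field_simp; ring
  rw [hexp, hθa, hθb]
  have habs := linear_sub_mul_sq_le hκ0 w₁ (Γ := 2 * Γ)
  have hlc1 : (2 - θ) * lc ≤ 2 * |lc| := by
    have h1 : (2 - θ) * lc ≤ (2 - θ) * |lc| :=
      mul_le_mul_of_nonneg_left (le_abs_self _) (by linarith)
    have h2 : (2 - θ) * |lc| ≤ 2 * |lc| := mul_le_mul_of_nonneg_right (by linarith) (abs_nonneg _)
    linarith
  have hκ2 : 0 ≤ κ * w₂ ^ 2 := mul_nonneg hκ0.le (sq_nonneg _)
  have e1 : 1 / (8 + ε) * w₁₂ ^ 2 = w₁₂ ^ 2 / (8 + ε) := by ring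
  rw [e1]
  linarith [hN, habs, hlc1, hκ2, hE]

end Entropy

/-! ### Theorem 7.2, last clause -/

/-- **Bamler 2020a, Thm. 7.2 (arXiv v1 Thm. 25), last clause: the Gaussian bound with the
entropy at the base point.** For `m ≥ 3`, `Λ ≥ 0` and `ε > 0` there is `C > 0` such that for
every Ricci flow on `[a, T]` of a smooth family of Riemannian metrics on a closed connected
manifold modelled on `ℝᵐ`, all `a < s < t < T` and radii `r` with `ε(t − s) ≤ r²`,
`a < s − r²`, and `R ≥ R_min` on `M × [s − r², t]` with `−R_min (t − s + r²) ≤ Λ`: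
(i) `K(x,t;y,s) ≤ C (t−s)^{−m/2} e^{−𝒩_{y,s}(r²)} exp(−d_s(z,y)²/((8+ε)(t−s)))` for every `z`
with `∫ d_s(z,·)² dν_{x,t;s} ≤ H_m (t−s)` (an `H_m`-centre), and
(ii) `K(x,t;y₁,s) K(x,t;y₂,s) ≤ C (t−s)^{−m} e^{−2𝒩_{y₁,s}(r²)} exp(−d_s(y₁,y₂)²/((8+ε)(t−s)))`,
where `𝒩_{y,s}(r²) = pointedNashEntropy h (kernel of (y, s)) m s (s − r²)`. Proof: Thm. 7.2
(`exists_heatKernelFn_le_gaussian`) with `ε/2`, the entropy estimate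
`neg_kernelNashEntropy_le_basePoint` (Prop. 5.2, Cor. 5.11, an `H_m`-centre), absorption of the
linear term, and for (ii) the interpolation trick of the source.
[cite: Bamler2020Entropy, §7.1 Thm. 7.2; §7.3, end of the proof of Thm. 7.2] -/
theorem exists_heatKernelFn_le_gaussian_basePoint (m : ℕ) (hm : 3 ≤ m) {Λ ε : ℝ} (hΛ : 0 ≤ Λ)
    (hε : 0 < ε) :
    ∃ C : ℝ, 0 < C ∧ ∀ {M : Type*} [TopologicalSpace M]
      [ChartedSpace (EuclideanSpace ℝ (Fin m)) M]
      [IsManifold 𝓘(ℝ, EuclideanSpace ℝ (Fin m)) ∞ M] [T2Space M] [CompactSpace M]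
      [SecondCountableTopology M] [MeasurableSpace M] [BorelSpace M] [ConnectedSpace M] [T3Space M]
      {h : ℝ → PseudoRiemannianMetric 𝓘(ℝ, EuclideanSpace ℝ (Fin m)) ∞ (EuclideanSpace ℝ (Fin m))
        (TangentSpace 𝓘(ℝ, EuclideanSpace ℝ (Fin m)) : M → Type _)}
      {cov : ℝ → CovariantDerivative 𝓘(ℝ, EuclideanSpace ℝ (Fin m)) (EuclideanSpace ℝ (Fin m))
        (TangentSpace 𝓘(ℝ, EuclideanSpace ℝ (Fin m)) : M → Type _)}
      {a T : ℝ} (hflow : IsRicciFlow h cov (Icc a T)) (hh : IsContMDiffFamilyOn ∞ h univ)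
      (hR : ∀ r, (h r).IsRiemannian),
      ∀ {s t : ℝ}, a < s → s < t → t < T → ∀ {r : ℝ}, ε * (t - s) ≤ r ^ 2 → a < s - r ^ 2 →
      ∀ {Rmin : ℝ},
      (∀ r' ∈ Icc (s - r ^ 2) t, ∀ z : M, Rmin ≤ (h r').scalarCurvatureWith (cov r') z) →
      -Rmin * (t - s + r ^ 2) ≤ Λ →
      (∀ x y z : M,
        ∫⁻ w, (h s).edist (hR s) z w ^ 2 ∂(heatKernelMeasure hh hR t x s) ≤
          ENNReal.ofReal ((((m : ℝ) - 1) * Real.pi ^ 2 / 2 + 4) * (t - s)) →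
        hflow.heatKernelFn hh hR t x (y, s) ≤
          C * (t - s) ^ (-(m : ℝ) / 2) *
            Real.exp (-(pointedNashEntropy h (fun r' v ↦ hflow.heatKernelFn hh hR s y (v, r')) m s
              (s - r ^ 2))) *
            Real.exp (-((h s).edist (hR s) z y).toReal ^ 2 / ((8 + ε) * (t - s)))) ∧
      (∀ x y₁ y₂ : M,
        hflow.heatKernelFn hh hR t x (y₁, s) * hflow.heatKernelFn hh hR t x (y₂, s) ≤
          C * (t - s) ^ (-(m : ℝ)) *
            Real.exp (-2 * pointedNashEntropy h (fun r' v ↦ hflow.heatKernelFn hh hR s y₁ (v, r'))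
              m s (s - r ^ 2)) *
            Real.exp (-((h s).edist (hR s) y₁ y₂).toReal ^ 2 / ((8 + ε) * (t - s)))) := by
  classical
  obtain ⟨C₁, hC₁, h72⟩ := exists_heatKernelFn_le_gaussian m hm hΛ (half_pos hε)
  -- the constant
  set Γ : ℝ := Real.sqrt ((m : ℝ) / (2 * ε) + Λ) with hΓ
  set κ : ℝ := 1 / (8 + ε / 2) - 1 / (8 + ε) with hκ
  have hκ0 : 0 < κ := by
    rw [hκ, sub_pos]
    exact one_div_lt_one_div_of_lt (by positivity) (by linarith)
  set Ml : ℝ := (m : ℝ) / 2 * Real.log (1 + 1 / ε) with hMl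
  have hMl0 : 0 ≤ Ml := by
    rw [hMl]
    exact mul_nonneg (by positivity) (Real.log_nonneg (by
      have : 0 < 1 / ε := by positivity
      linarith))
  set Hm : ℝ := ((m : ℝ) - 1) * Real.pi ^ 2 / 2 + 4 with hHm
  have hHm0 : 0 ≤ Hm := by
    have h3 : (3 : ℝ) ≤ m := by exact_mod_cast hm
    have h1 : 0 ≤ ((m : ℝ) - 1) * Real.pi ^ 2 := mul_nonneg (by linarith) (sq_nonneg _)
    rw [hHm]; linarith
  set E : ℝ := 2 * |Real.log C₁| + 2 * (Ml + Γ * Real.sqrt Hm) + (2 * Γ) ^ 2 / (4 * κ) +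
    Γ ^ 2 / (4 * κ) with hEdef
  have hE₁ : |Real.log C₁| + Ml + Γ * Real.sqrt Hm + Γ ^ 2 / (4 * κ) ≤ E := by
    have h1 : 0 ≤ |Real.log C₁| := abs_nonneg _
    have h2 : 0 ≤ Γ * Real.sqrt Hm := by positivity
    have h3 : 0 ≤ (2 * Γ) ^ 2 / (4 * κ) := by positivity
    rw [hEdef]; linarith
  have hE₂ : 2 * |Real.log C₁| + 2 * (Ml + Γ * Real.sqrt Hm) + (2 * Γ) ^ 2 / (4 * κ) ≤ E := by
    have h3 : 0 ≤ Γ ^ 2 / (4 * κ) := by positivity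
    rw [hEdef]; linarith
  refine ⟨Real.exp E, Real.exp_pos E, ?_⟩
  intro M _ _ _ _ _ _ _ _ _ _ h cov a T hflow hh hR s t has hst htT r hr hasr Rmin hRmin hRΛ
  have hτ0 : 0 < t - s := sub_pos.2 hst
  have hr2 : 0 < r ^ 2 := lt_of_lt_of_le (mul_pos hε hτ0) hr
  -- the lower scalar curvature bound on `[s, t]` and at `s − r²`
  have hRmin' : ∀ r' ∈ Icc s t, ∀ z : M, Rmin ≤ (h r').scalarCurvatureWith (cov r') z :=
    fun r' hr' z ↦ hRmin r' ⟨by linarith [hr'.1], hr'.2⟩ z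
  have hRminσ : ∀ w : M, Rmin ≤ (h (s - r ^ 2)).scalarCurvatureWith (cov (s - r ^ 2)) w :=
    fun w ↦ hRmin (s - r ^ 2) ⟨le_rfl, by linarith⟩ w
  have hRΛ' : -Rmin * (t - s) ≤ Λ := by
    rcases le_or_gt Rmin 0 with h0 | h0
    · have : -Rmin * (t - s) ≤ -Rmin * (t - s + r ^ 2) :=
        mul_le_mul_of_nonneg_left (by linarith) (by linarith)
      exact this.trans hRΛ
    · have : -Rmin * (t - s) ≤ 0 := by nlinarith
      linarith
  obtain ⟨h15, h16⟩ := h72 hflow hh hR has hst htT hRmin' hRΛ'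
  refine ⟨fun x y z hz ↦ ?_, fun x y₁ y₂ ↦ ?_⟩
  · exact heatKernelFn_le_gaussian_basePoint_of_le hflow hh hR hm hε hasr hst htT hr hRminσ hRΛ'
      hC₁ hE₁ x y z hz (h15 x y z hz)
  · -- an `H_m`-centre `z` of `(x, t)` at time `s`
    have hs_mem : s ∈ Icc a T := ⟨has.le, (hst.trans htT).le⟩
    have ht_mem : t ∈ Icc a T := ⟨(has.trans hst).le, htT.le⟩
    have hmpos : 0 < m := lt_of_lt_of_le (by norm_num) hm
    have hH := ricciFlowMetricFlow_isHConcentrated hmpos hh hR Set.ordConnected_Icc hflow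
    obtain ⟨z, hzc⟩ := hH.exists_isHCenter (s := ⟨s, hs_mem⟩) (t := ⟨t, ht_mem⟩) hst.le x
    have hz : ∫⁻ w, (h s).edist (hR s) z w ^ 2 ∂(heatKernelMeasure hh hR t x s) ≤
        ENNReal.ofReal ((((m : ℝ) - 1) * Real.pi ^ 2 / 2 + 4) * (t - s)) :=
      hzc.lintegral_edist_sq_le
    have hpos : ∀ y : M, 0 < hflow.heatKernelFn hh hR t x (y, s) := fun y ↦
      hflow.heatKernelFn_pos hh hR ⟨has.trans hst, htT.le⟩ x ⟨mem_univ _, has, hst⟩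
    exact heatKernelFn_mul_le_gaussian_basePoint_of_le hflow hh hR hm hε hasr hst htT hr hRminσ
      hRΛ' hC₁ hE₂ x y₁ y₂ z (hpos y₁) (hpos y₂) hz (h15 x y₁ z hz) (h15 x y₂ z hz) (h16 x y₁ y₂)

end Literature.Geometry.Riemannian

end
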